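import Literature.NumberTheory.Automorphic.UnitaryGroupCohomologicalFormsSmooth
import Literature.AlgebraicGeometry.ShimuraVarieties.UnitaryBallCauchyRiemann
import HarnessLib

/-!
# Pull-back of holomorphic / cohomological cotangent forms along a homomorphism of unitary adelic groups intertwining the
# archimedean sections up to COMPLEX CONJUGATION of `U(2,1)` — the antiholomorphic transport

Topic `NumberTheory/Automorphic`; namespaces `Literature.Geometry.ComplexHyperbolic.BallModel` (§1),
`Literature.AlgebraicGeometry.ShimuraVarieties.BallForms` (§1) and `Literature.NumberTheory.Automorphic.UnitaryGroup.CotangentForms` (§2–§4).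
KERNEL: one definition by explicit formula (`BallModel.conjU21`, entrywise complex conjugation on `U(2,1) ⊂ GL₃(ℂ)`) + theorems;
no named fact, no instance, no notation, no `sorry`.  Cell hodgecm-mathlib (D-0151), floor 0, programme P2: the archimedean half of the
ORIENTATION cases of the letter Θ-OCC-GEN of crux H413 (a holomorphic engine at the canonical representative of a complex place produces
cotangent forms at ANY frame once forms can be pulled back along `u ↦ ū`).

* §1 `conjU21 : U(2,1) →* U(2,1)`, `g ↦ ḡ` (`J = diag(1,1,−1)` is real): an involution fixing the stabiliser of the base point `x₀ = 0`,
  with `Jac ḡ x₀ = \overline{Jac g x₀}` and `\overline{exp X_b} = exp X_{b̄}` (`conjU21_expP`).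
* §2 For two unitary data `U(J₁)`, `U(J₂)` over the same `(F, E, c, N)`, a homomorphism `κ : U(J₁)(𝔸) →* U(J₂)(𝔸)` carrying rational points to
  rational points, `K_{c,1}` into `K_{c,2}`, finite-adelic right translations to finite-adelic right translations (`κ (x·(1,g)) = κ x · (1, κ_f g)`,
  `κ_f` continuous), and INTERTWINING the archimedean sections, `κ ∘ ι₁ = ι₂`: `Φ ∈ holCotForms ι₂ K_{c,2} ⇒ Φ ∘ κ ∈ holCotForms ι₁ K_{c,1}`
  (`mem_holCotForms_comp`).
* §3 The same with the sections intertwined UP TO CONJUGATION, `κ ∘ ι₁ = ι₂ ∘ conjU21`: `Φ ∈ holCotForms ι₂ K_{c,2} ⇒ conjFun (Φ ∘ κ) ∈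
  holCotForms ι₁ K_{c,1}` (`conjFun_comp_mem_holCotForms_of_conj`) — the weight `(Jac k x₀)ᵀ` is real-algebraic in `k`, and the probe of
  `\overline{Φ ∘ κ}` along `ι₁` is `star ∘ (probe of Φ along ι₂) ∘ star`, whose real differential is again `ℂ`-linear.
* §4 `cohForms = hol ⊔ conj hol` is carried to `cohForms` in both cases (`mem_cohForms_comp`, `mem_cohForms_comp_of_conj`).

References: [Borel1997] A. Borel, *Automorphic forms on SL₂(ℝ)* (1997), §5.14; [BorelWallach2000] A. Borel, N. Wallach, 2nd ed. (2000), VII 2.10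
(holomorphic and antiholomorphic cotangent forms are exchanged by conjugation); [BorelJacquet1979] §4.1–4.2; [Jacobowitz1990] Ch. 2 §1
(`U(2,1)` and the ball).  Nothing of print is asserted; HC_CM is proved only modulo the printed citations until rung 0 closes.
-/

noncomputable section

open NumberField MulAction
open scoped Matrix ComplexConjugate

/-! ## §1 Entrywise complex conjugation on `U(2,1)` -/

namespace Literature.Geometry.ComplexHyperbolic.BallModel

/-- `J = diag(1,1,−1)` has real entries: `J̄ = J`. [folklore] -/
private theorem J_map_conj : J.map (starRingEnd ℂ) = J := by
  rw [J, Matrix.diagonal_map (map_zero _)]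
  congr 1
  funext i
  fin_cases i <;> simp

/-- **Entrywise complex conjugation `g ↦ ḡ` on `U(2,1)`** (an automorphism, since `J` is real). [cite: Jacobowitz1990, Ch. 2 §1 (p. 40)] -/
def conjU21 : U21 →* U21 :=
  ((Matrix.GeneralLinearGroup.map (n := Fin 3) (starRingEnd ℂ)).restrict U21).codRestrict U21 fun g => by
    show (((g : GL3) : Matrix (Fin 3) (Fin 3) ℂ).map (starRingEnd ℂ))ᴴ * J * ((g : GL3) : Matrix (Fin 3) (Fin 3) ℂ).map (starRingEnd ℂ) = J
    have h := congrArg (fun M : Matrix (Fin 3) (Fin 3) ℂ => M.map (starRingEnd ℂ)) (mat_mem g)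
    simp only [Matrix.map_mul, J_map_conj] at h
    have hc : (((g : GL3) : Matrix (Fin 3) (Fin 3) ℂ).map (starRingEnd ℂ))ᴴ = (((g : GL3) : Matrix (Fin 3) (Fin 3) ℂ)ᴴ).map (starRingEnd ℂ) :=
      (Matrix.conjTranspose_map (starRingEnd ℂ) (fun z => by simp)).symm
    rw [hc]
    exact h

/-- `mat ḡ = \overline{mat g}`. [cite: Jacobowitz1990, Ch. 2 §1 (p. 40)] -/
@[simp] theorem mat_conjU21 (g : U21) : mat (conjU21 g) = (mat g).map (starRingEnd ℂ) := rfl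

/-- entries of `ḡ`. [cite: Jacobowitz1990, Ch. 2 §1 (p. 40)] -/
theorem mat_conjU21_apply (g : U21) (i j : Fin 3) : mat (conjU21 g) i j = starRingEnd ℂ (mat g i j) := rfl

/-- `g ↦ ḡ` is an involution. [cite: Jacobowitz1990, Ch. 2 §1 (p. 40)] -/
@[simp] theorem conjU21_conjU21 (g : U21) : conjU21 (conjU21 g) = g :=
  mat_injective (by rw [mat_conjU21, mat_conjU21, Matrix.map_map]; ext i j; simp)

/-- `ḡ · (x₀, 1) = \overline{g · (x₀, 1)}` at the base point `x₀ = 0`. [folklore] -/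
private theorem W3_conjU21_x₀ (g : U21) (k : Fin 3) : W3 (conjU21 g) x₀ k = starRingEnd ℂ (W3 g x₀ k) := by
  rw [W3_apply, W3_apply, mat_conjU21_apply, mat_conjU21_apply, mat_conjU21_apply, x₀_val]
  simp

/-- coordinates of `ḡ • x₀` are the conjugates of those of `g • x₀`. [folklore] -/
private theorem conjU21_smul_x₀_val (g : U21) (i : Fin 2) : ((conjU21 g • x₀).1 i) = starRingEnd ℂ ((g • x₀).1 i) := by
  rw [smul_val, smul_val, W3_conjU21_x₀, W3_conjU21_x₀, map_div₀]

/-- `ḡ` fixes `x₀` iff `g` does (the action is `z ↦ \overline{g • z̄}`). [cite: Jacobowitz1990, Ch. 2 §1, Lemma 6 (p. 41)] -/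
theorem conjU21_smul_x₀_eq_iff (g : U21) : conjU21 g • x₀ = x₀ ↔ g • x₀ = x₀ := by
  constructor
  · intro h
    apply Ball.ext
    intro i
    have hi := congrArg (fun z : Ball => z.1 i) h
    simp only [conjU21_smul_x₀_val, x₀_val, Pi.zero_apply, map_eq_zero] at hi
    rw [hi, x₀_val, Pi.zero_apply]
  · intro h
    apply Ball.ext
    intro i
    rw [conjU21_smul_x₀_val, h, x₀_val, Pi.zero_apply, map_zero]

/-- `g ↦ ḡ` preserves the stabiliser of `x₀`. [cite: Jacobowitz1990, Ch. 2 §1, Lemma 6 (p. 41)] -/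
theorem conjU21_mem_stabilizer {g : U21} (hg : g ∈ stabilizer U21 x₀) : conjU21 g ∈ stabilizer U21 x₀ := by
  rw [mem_stabilizer_iff] at hg ⊢
  exact (conjU21_smul_x₀_eq_iff g).2 hg

/-- **`Jac ḡ x₀ = \overline{Jac g x₀}`**: the holomorphic Jacobian of `z ↦ ḡ • z = \overline{g • z̄}` at `x₀ = 0`. [cite: Borel1997, §5.14] [cite: Jacobowitz1990, Ch. 2 §1 (p. 40)] -/
theorem Jac_conjU21_x₀ (g : U21) : Jac (conjU21 g) x₀ = (Jac g x₀).map (starRingEnd ℂ) := by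
  ext i j
  simp only [Jac, Matrix.of_apply, Matrix.map_apply, W3_conjU21_x₀, mat_conjU21_apply, map_sub, map_mul, map_div₀, map_pow]

/-- `g ↦ ḡ` restricted to the stabiliser of `x₀`. [cite: Jacobowitz1990, Ch. 2 §1, Lemma 6 (p. 41)] -/
def conjStab : stabilizer U21 x₀ →* stabilizer U21 x₀ :=
  (conjU21.restrict (stabilizer U21 x₀)).codRestrict _ fun k => conjU21_mem_stabilizer k.2

/-- `conjStab k = k̄` in `U(2,1)`. [cite: Jacobowitz1990, Ch. 2 §1 (p. 40)] -/
@[simp] theorem coe_conjStab (k : stabilizer U21 x₀) : ((conjStab k : stabilizer U21 x₀) : U21) = conjU21 (k : U21) := rfl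

/-- `conjStab` is an involution. [cite: Jacobowitz1990, Ch. 2 §1 (p. 40)] -/
@[simp] theorem conjStab_conjStab (k : stabilizer U21 x₀) : conjStab (conjStab k) = k :=
  Subtype.ext (conjU21_conjU21 (k : U21))

end Literature.Geometry.ComplexHyperbolic.BallModel

namespace Literature.AlgebraicGeometry.ShimuraVarieties.BallForms

open Literature.Geometry.ComplexHyperbolic Literature.Geometry.ComplexHyperbolic.BallModel

/-- `X_{b̄} = \overline{X_b}`. [folklore] -/
private theorem pMat_star (b : Fin 2 → ℂ) : pMat (star b) = (pMat b).map (starRingEnd ℂ) := by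
  ext i j
  fin_cases i <;> fin_cases j <;> simp [pMat]

/-- **`\overline{exp X_b} = exp X_{b̄}`** (`exp` commutes with the continuous ring endomorphism `conj` of `M₃(ℂ)`): the exponential `𝔭`-chart of
[Borel1997, §5.14] is real-analytic. [cite: Borel1997, §5.14] -/
theorem conjU21_expP (b : Fin 2 → ℂ) : conjU21 (expP b) = expP (star b) := by
  apply mat_injective
  rw [mat_conjU21, mat_expP, mat_expP, pMat_star]
  have h : ((pMat b).map (starRingEnd ℂ)) = ((pMat b)ᵀ)ᴴ := by
    rw [Matrix.conjTranspose, Matrix.transpose_transpose]; rfl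
  rw [h, Matrix.exp_conjTranspose, Matrix.exp_transpose, Matrix.conjTranspose, Matrix.transpose_transpose]
  rfl

/-- the cotangent weight at `x₀` is real-algebraic: `star ((Jac k̄ x₀)ᵀ v) = (Jac k x₀)ᵀ (star v)`. [folklore] -/
private theorem star_transpose_Jac_conjU21_mulVec (k : U21) (v : Fin 2 → ℂ) :
    star ((Jac (conjU21 k) x₀)ᵀ *ᵥ v) = (Jac k x₀)ᵀ *ᵥ star v := by
  rw [Jac_conjU21_x₀]
  ext i
  simp only [Matrix.mulVec, dotProduct, Matrix.transpose_apply, Matrix.map_apply, Pi.star_apply, star_sum, star_mul',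
    RCLike.star_def, RingHomCompTriple.comp_apply, RingHom.id_apply]

/-- the weight `weightOf x₀` along `conjStab`: `star (τ(k̄⁻¹) v) = τ(k⁻¹) (star v)`. [cite: Borel1997, §5.14] -/
theorem star_weightOf_conjStab_inv (k : stabilizer U21 x₀) (v : Fin 2 → ℂ) :
    star (isPullbackCocycle_cotangentCocycle.weightOf x₀ (conjStab k)⁻¹ v) =
      isPullbackCocycle_cotangentCocycle.weightOf x₀ k⁻¹ (star v) := by
  rw [Literature.NumberTheory.Automorphic.AutomorphyFactor.IsPullbackCocycle.weightOf_inv_apply,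
    Literature.NumberTheory.Automorphic.AutomorphyFactor.IsPullbackCocycle.weightOf_inv_apply, coe_conjStab,
    cotangentCocycle_apply, cotangentCocycle_apply, star_transpose_Jac_conjU21_mulVec]

end Literature.AlgebraicGeometry.ShimuraVarieties.BallForms

/-! ## §2 Pull-back of cotangent forms along a homomorphism intertwining the archimedean sections -/

namespace Literature.NumberTheory.Automorphic.UnitaryGroup.CotangentForms

open Literature.AlgebraicGeometry.ShimuraVarieties Literature.AlgebraicGeometry.ShimuraVarieties.BallForms
open Literature.Geometry.ComplexHyperbolic Literature.Geometry.ComplexHyperbolic.BallModel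

variable {F E : Type} [Field F] [NumberField F] [Field E] [NumberField E] [Algebra F E]
  {c : E ≃ₐ[F] E} {N : ℕ} {J₁ J₂ : Matrix (Fin N) (Fin N) E}
  {ι₁ : U21 →* (adelicGroupData F E c N J₁).Adelic} {ι₂ : U21 →* (adelicGroupData F E c N J₂).Adelic}
  {Kc₁ : Subgroup (adelicGroupData F E c N J₁).Adelic} {Kc₂ : Subgroup (adelicGroupData F E c N J₂).Adelic}
  {κ : (adelicGroupData F E c N J₁).Adelic →* (adelicGroupData F E c N J₂).Adelic}
  {κf : finAdelic F E c N J₁ →* finAdelic F E c N J₂}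

/-- probes along intertwined sections: `germ_{ι₁}(Φ ∘ κ)(y) = germ_{ι₂}(Φ)(κ y)`. [cite: Borel1997, §5.14] -/
theorem germAt_comp (hrel : ∀ u : U21, κ (ι₁ u) = ι₂ u) (Φ : (adelicGroupData F E c N J₂).Adelic → (Fin 2 → ℂ))
    (y : (adelicGroupData F E c N J₁).Adelic) : germAt ι₁ (fun x => Φ (κ x)) y = germAt ι₂ Φ (κ y) := by
  funext b
  show Φ (κ (y * ι₁ (expP b))) = Φ (κ y * ι₂ (expP b))
  rw [map_mul, hrel]

/-- holomorphic germs pull back along intertwined sections. [cite: Borel1997, §5.14] [cite: BorelWallach2000, VII 2.10] -/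
theorem isHolGerm_comp (hrel : ∀ u : U21, κ (ι₁ u) = ι₂ u) {Φ : (adelicGroupData F E c N J₂).Adelic → (Fin 2 → ℂ)}
    (hΦ : IsHolGerm ι₂ Φ) : IsHolGerm ι₁ (fun x => Φ (κ x)) :=
  ⟨fun y => by rw [germAt_comp hrel]; exact hΦ.1 (κ y), fun y v => by rw [germAt_comp hrel]; exact hΦ.2 (κ y) v⟩

/-- weight forms pull back along a homomorphism carrying `Γ₁` into `Γ₂` and intertwining the sections. [cite: Borel1997, §5.14] -/
theorem mem_weightForms_comp (hrel : ∀ u : U21, κ (ι₁ u) = ι₂ u)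
    {Γ₁ : Subgroup (adelicGroupData F E c N J₁).Adelic} {Γ₂ : Subgroup (adelicGroupData F E c N J₂).Adelic}
    (hΓ : ∀ γ ∈ Γ₁, κ γ ∈ Γ₂) {S : Subgroup U21} {R W : Type*} [CommRing R] [AddCommGroup W] [Module R W]
    {τ : Representation R S W} {Φ : (adelicGroupData F E c N J₂).Adelic → W} (hΦ : Φ ∈ weightForms Γ₂ (ι₂.comp S.subtype) τ) :
    (fun x => Φ (κ x)) ∈ weightForms Γ₁ (ι₁.comp S.subtype) τ := by
  refine ⟨fun γ hγ g => ?_, fun k g => ?_⟩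
  · show Φ (κ (γ * g)) = Φ (κ g)
    rw [map_mul, hΦ.1 (κ γ) (hΓ γ hγ) (κ g)]
  · show Φ (κ (g * ι₁ (k : U21))) = τ k⁻¹ (Φ (κ g))
    rw [map_mul, hrel]
    exact hΦ.2 k (κ g)

/-- smooth vectors pull back along a homomorphism compatible with a CONTINUOUS homomorphism of the finite-adelic groups (a vector fixed by
an open `K_f ≤ U(J₂)(𝔸_f)` pulls back to one fixed by the open `κ_f⁻¹ K_f`). [cite: BorelJacquet1979, §4.2] -/
theorem mem_smoothFun_comp (hfin : ∀ g, κ (finAdelicToAdelic F E c N J₁ g) = finAdelicToAdelic F E c N J₂ (κf g)) (hκf : Continuous κf)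
    {Φ : (adelicGroupData F E c N J₂).Adelic → (Fin 2 → ℂ)} (hΦ : Φ ∈ smoothFun F E c N J₂) :
    (fun x => Φ (κ x)) ∈ smoothFun F E c N J₁ := by
  let Lκ : ((adelicGroupData F E c N J₂).Adelic → (Fin 2 → ℂ)) →ₗ[ℂ] ((adelicGroupData F E c N J₁).Adelic → (Fin 2 → ℂ)) :=
    LinearMap.funLeft ℂ (Fin 2 → ℂ) κ
  have hLκ : ∀ Ψ : (adelicGroupData F E c N J₂).Adelic → (Fin 2 → ℂ), Lκ Ψ = fun x => Ψ (κ x) := fun _ => rfl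
  have hle : (smoothFun F E c N J₂).map Lκ ≤ smoothFun F E c N J₁ := by
    unfold smoothFun
    simp only [Submodule.map_iSup]
    refine iSup₂_le fun Kf hKf => ?_
    refine le_iSup₂_of_le (Kf.comap κf) (hKf.preimage hκf) ?_
    intro Ψ hΨ
    obtain ⟨Φ', hΦ', rfl⟩ := Submodule.mem_map.mp hΨ
    rw [Representation.mem_invariants] at hΦ' ⊢
    intro k
    have hk : rightRep F E c N J₂ (κf (k : finAdelic F E c N J₁)) Φ' = Φ' := hΦ' ⟨κf k, k.2⟩
    funext x
    show Φ' (κ (x * finAdelicToAdelic F E c N J₁ k)) = Φ' (κ x)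
    rw [map_mul, hfin]
    exact congrFun hk (κ x)
  rw [← hLκ]
  exact hle (Submodule.mem_map_of_mem hΦ)

/-- **HOLOMORPHIC cotangent forms pull back along `κ` with `κ ∘ ι₁ = ι₂`** (rational points to rational points, `K_{c,1}` into `K_{c,2}`, finite
right translations to finite right translations). [cite: Borel1997, §5.14] [cite: BorelWallach2000, VII 2.10] [cite: BorelJacquet1979, §4.2] -/
theorem mem_holCotForms_comp (hrel : ∀ u : U21, κ (ι₁ u) = ι₂ u)
    (hΓ : ∀ γ ∈ (adelicGroupData F E c N J₁).toAdelic.range, κ γ ∈ (adelicGroupData F E c N J₂).toAdelic.range)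
    (hK : ∀ k ∈ Kc₁, κ k ∈ Kc₂)
    (hfin : ∀ g, κ (finAdelicToAdelic F E c N J₁ g) = finAdelicToAdelic F E c N J₂ (κf g)) (hκf : Continuous κf)
    {Φ : (adelicGroupData F E c N J₂).Adelic → (Fin 2 → ℂ)} (hΦ : Φ ∈ holCotForms F E c N J₂ ι₂ Kc₂) :
    (fun x => Φ (κ x)) ∈ holCotForms F E c N J₁ ι₁ Kc₁ := by
  rw [mem_holCotForms_iff] at hΦ ⊢
  obtain ⟨hw, hKi, hs, hh⟩ := hΦ
  refine ⟨mem_weightForms_comp hrel hΓ hw, fun k hk x => ?_, mem_smoothFun_comp hfin hκf hs, isHolGerm_comp hrel hh⟩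
  show Φ (κ (x * k)) = Φ (κ x)
  rw [map_mul, hKi (κ k) (hK k hk)]

/-! ## §3 Antiholomorphic pull-back: sections intertwined up to `conjU21` -/

/-- probes along sections intertwined up to conjugation: `germ_{ι₁}(\overline{Φ ∘ κ})(y) = star ∘ germ_{ι₂}(Φ)(κ y) ∘ star`.
[cite: Borel1997, §5.14] -/
theorem germAt_conjFun_comp_of_conj (hrel : ∀ u : U21, κ (ι₁ u) = ι₂ (conjU21 u))
    (Φ : (adelicGroupData F E c N J₂).Adelic → (Fin 2 → ℂ)) (y : (adelicGroupData F E c N J₁).Adelic) :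
    germAt ι₁ (conjFun F E c N J₁ fun x => Φ (κ x)) y = fun b => star (germAt ι₂ Φ (κ y) (star b)) := by
  funext b
  show star (Φ (κ (y * ι₁ (expP b)))) = star (Φ (κ y * ι₂ (expP (star b))))
  rw [map_mul, hrel, conjU21_expP]

/-- holomorphic germs become holomorphic germs of the CONJUGATE pull-back when the sections are intertwined up to `conjU21`
(the real differential of `star ∘ L ∘ star` is `ℂ`-linear when that of `L` is). [cite: Borel1997, §5.14] [cite: BorelWallach2000, VII 2.10] -/
theorem isHolGerm_conjFun_comp_of_conj (hrel : ∀ u : U21, κ (ι₁ u) = ι₂ (conjU21 u))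
    {Φ : (adelicGroupData F E c N J₂).Adelic → (Fin 2 → ℂ)} (hΦ : IsHolGerm ι₂ Φ) :
    IsHolGerm ι₁ (conjFun F E c N J₁ fun x => Φ (κ x)) := by
  -- complex conjugation on `ℂ²` as a real-linear homeomorphism
  let σ : (Fin 2 → ℂ) ≃L[ℝ] (Fin 2 → ℂ) := starL' ℝ
  have hσ : ∀ v : Fin 2 → ℂ, σ v = star v := fun _ => rfl
  have hσ0 : σ 0 = 0 := by rw [hσ, star_zero]
  have key : ∀ y, germAt ι₁ (conjFun F E c N J₁ fun x => Φ (κ x)) y = fun b => σ (germAt ι₂ Φ (κ y) (σ b)) := fun y => by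
    rw [germAt_conjFun_comp_of_conj hrel]
    rfl
  -- the differential of the pulled-back probe
  have hD : ∀ y, HasFDerivAt (germAt ι₁ (conjFun F E c N J₁ fun x => Φ (κ x)) y)
      ((σ : (Fin 2 → ℂ) →L[ℝ] (Fin 2 → ℂ)).comp ((fderiv ℝ (germAt ι₂ Φ (κ y)) 0).comp (σ : (Fin 2 → ℂ) →L[ℝ] (Fin 2 → ℂ)))) 0 := by
    intro y
    rw [key y]
    have h1 : HasFDerivAt (germAt ι₂ Φ (κ y)) (fderiv ℝ (germAt ι₂ Φ (κ y)) 0) (σ 0) := by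
      rw [hσ0]; exact (hΦ.1 (κ y)).hasFDerivAt
    exact σ.hasFDerivAt.comp 0 (h1.comp 0 σ.hasFDerivAt)
  refine ⟨fun y => (hD y).differentiableAt, fun y v => ?_⟩
  rw [(hD y).fderiv]
  simp only [ContinuousLinearMap.comp_apply, ContinuousLinearEquiv.coe_coe, hσ, star_smul, Complex.star_def,
    Complex.conj_I, neg_smul, map_neg, hΦ.2 (κ y) (star v), neg_neg]

/-- weight forms: the conjugate pull-back of a form of weight `weightOf x₀` along `ι₂` has weight `weightOf x₀` along `ι₁` when `κ ∘ ι₁ = ι₂ ∘ conjU21`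
(the stabiliser of `x₀` is `conjU21`-stable and `\overline{(Jac k̄ x₀)ᵀ v} = (Jac k x₀)ᵀ v̄`). [cite: Borel1997, §5.14] -/
theorem conjFun_comp_mem_weightForms_of_conj (hrel : ∀ u : U21, κ (ι₁ u) = ι₂ (conjU21 u))
    {Γ₁ : Subgroup (adelicGroupData F E c N J₁).Adelic} {Γ₂ : Subgroup (adelicGroupData F E c N J₂).Adelic}
    (hΓ : ∀ γ ∈ Γ₁, κ γ ∈ Γ₂) {Φ : (adelicGroupData F E c N J₂).Adelic → (Fin 2 → ℂ)}
    (hΦ : Φ ∈ weightForms Γ₂ (ι₂.comp (stabilizer U21 x₀).subtype) (isPullbackCocycle_cotangentCocycle.weightOf x₀)) :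
    conjFun F E c N J₁ (fun x => Φ (κ x)) ∈ weightForms Γ₁ (ι₁.comp (stabilizer U21 x₀).subtype) (isPullbackCocycle_cotangentCocycle.weightOf x₀) := by
  refine ⟨fun γ hγ g => ?_, fun k g => ?_⟩
  · show star (Φ (κ (γ * g))) = star (Φ (κ g))
    rw [map_mul, hΦ.1 (κ γ) (hΓ γ hγ) (κ g)]
  · have h2 : Φ (κ g * ι₂ ((conjStab k : stabilizer U21 x₀) : U21)) = isPullbackCocycle_cotangentCocycle.weightOf x₀ (conjStab k)⁻¹ (Φ (κ g)) :=
      hΦ.2 (conjStab k) (κ g)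
    show star (Φ (κ (g * ι₁ (k : U21)))) = isPullbackCocycle_cotangentCocycle.weightOf x₀ k⁻¹ (star (Φ (κ g)))
    rw [map_mul, hrel, ← coe_conjStab, h2, star_weightOf_conjStab_inv]

/-- **ANTIHOLOMORPHIC PULL-BACK: `Φ ∈ holCotForms ι₂ K_{c,2} ⇒ \overline{Φ ∘ κ} ∈ holCotForms ι₁ K_{c,1}` when `κ ∘ ι₁ = ι₂ ∘ conjU21`**
(rational points to rational points, `K_{c,1}` into `K_{c,2}`, finite right translations to finite right translations). [cite: Borel1997, §5.14]
[cite: BorelWallach2000, VII 2.10] [cite: BorelJacquet1979, §4.2] -/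
theorem conjFun_comp_mem_holCotForms_of_conj (hrel : ∀ u : U21, κ (ι₁ u) = ι₂ (conjU21 u))
    (hΓ : ∀ γ ∈ (adelicGroupData F E c N J₁).toAdelic.range, κ γ ∈ (adelicGroupData F E c N J₂).toAdelic.range)
    (hK : ∀ k ∈ Kc₁, κ k ∈ Kc₂)
    (hfin : ∀ g, κ (finAdelicToAdelic F E c N J₁ g) = finAdelicToAdelic F E c N J₂ (κf g)) (hκf : Continuous κf)
    {Φ : (adelicGroupData F E c N J₂).Adelic → (Fin 2 → ℂ)} (hΦ : Φ ∈ holCotForms F E c N J₂ ι₂ Kc₂) :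
    conjFun F E c N J₁ (fun x => Φ (κ x)) ∈ holCotForms F E c N J₁ ι₁ Kc₁ := by
  rw [mem_holCotForms_iff] at hΦ ⊢
  obtain ⟨hw, hKi, hs, hh⟩ := hΦ
  refine ⟨conjFun_comp_mem_weightForms_of_conj hrel hΓ hw, fun k hk x => ?_, conjFun_mem_smoothFun (mem_smoothFun_comp hfin hκf hs),
    isHolGerm_conjFun_comp_of_conj hrel hh⟩
  show star (Φ (κ (x * k))) = star (Φ (κ x))
  rw [map_mul, hKi (κ k) (hK k hk)]

/-! ## §4 Cohomological forms `hol ⊔ conj hol` pull back in both cases -/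

/-- `conjFun` is an involution. [folklore] -/
private theorem conjFun_conjFun' (Φ : (adelicGroupData F E c N J₁).Adelic → (Fin 2 → ℂ)) : conjFun F E c N J₁ (conjFun F E c N J₁ Φ) = Φ := by
  funext x
  rw [conjFun_apply, conjFun_apply, star_star]

/-- `\overline{Φ ∘ κ} = \overline{Φ} ∘ κ` (definitional). [folklore] -/
private theorem conjFun_comp_eq (Φ : (adelicGroupData F E c N J₂).Adelic → (Fin 2 → ℂ)) :
    conjFun F E c N J₁ (fun x => Φ (κ x)) = fun x => conjFun F E c N J₂ Φ (κ x) := rfl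

/-- **cohomological cotangent forms pull back along `κ` with `κ ∘ ι₁ = ι₂`.** [cite: BorelWallach2000, VII 2.10] -/
theorem mem_cohForms_comp (hrel : ∀ u : U21, κ (ι₁ u) = ι₂ u)
    (hΓ : ∀ γ ∈ (adelicGroupData F E c N J₁).toAdelic.range, κ γ ∈ (adelicGroupData F E c N J₂).toAdelic.range)
    (hK : ∀ k ∈ Kc₁, κ k ∈ Kc₂)
    (hfin : ∀ g, κ (finAdelicToAdelic F E c N J₁ g) = finAdelicToAdelic F E c N J₂ (κf g)) (hκf : Continuous κf)
    {Φ : (adelicGroupData F E c N J₂).Adelic → (Fin 2 → ℂ)} (hΦ : Φ ∈ cohForms F E c N J₂ ι₂ Kc₂) :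
    (fun x => Φ (κ x)) ∈ cohForms F E c N J₁ ι₁ Kc₁ := by
  unfold cohForms at hΦ ⊢
  obtain ⟨Φ₁, h₁, Φ₂, h₂, rfl⟩ := Submodule.mem_sup.mp hΦ
  obtain ⟨Ψ, hΨ, rfl⟩ := Submodule.mem_map.mp h₂
  have hsum : (fun x => (Φ₁ + conjFun F E c N J₂ Ψ) (κ x)) = (fun x => Φ₁ (κ x)) + conjFun F E c N J₁ (fun x => Ψ (κ x)) := rfl
  rw [hsum]
  exact Submodule.add_mem_sup (mem_holCotForms_comp hrel hΓ hK hfin hκf h₁)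
    (Submodule.mem_map_of_mem (mem_holCotForms_comp hrel hΓ hK hfin hκf hΨ))

/-- **cohomological cotangent forms pull back along `κ` with `κ ∘ ι₁ = ι₂ ∘ conjU21`** (hol ↦ conj hol, conj hol ↦ hol).
[cite: BorelWallach2000, VII 2.10] -/
theorem mem_cohForms_comp_of_conj (hrel : ∀ u : U21, κ (ι₁ u) = ι₂ (conjU21 u))
    (hΓ : ∀ γ ∈ (adelicGroupData F E c N J₁).toAdelic.range, κ γ ∈ (adelicGroupData F E c N J₂).toAdelic.range)
    (hK : ∀ k ∈ Kc₁, κ k ∈ Kc₂)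
    (hfin : ∀ g, κ (finAdelicToAdelic F E c N J₁ g) = finAdelicToAdelic F E c N J₂ (κf g)) (hκf : Continuous κf)
    {Φ : (adelicGroupData F E c N J₂).Adelic → (Fin 2 → ℂ)} (hΦ : Φ ∈ cohForms F E c N J₂ ι₂ Kc₂) :
    (fun x => Φ (κ x)) ∈ cohForms F E c N J₁ ι₁ Kc₁ := by
  unfold cohForms at hΦ ⊢
  obtain ⟨Φ₁, h₁, Φ₂, h₂, rfl⟩ := Submodule.mem_sup.mp hΦ
  obtain ⟨Ψ, hΨ, rfl⟩ := Submodule.mem_map.mp h₂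
  -- `Φ₁ ∘ κ = conj (conj (Φ₁ ∘ κ))` with `conj (Φ₁ ∘ κ)` holomorphic; `(conj Ψ) ∘ κ = conj (Ψ ∘ κ)` holomorphic
  have hsum : (fun x => (Φ₁ + conjFun F E c N J₂ Ψ) (κ x)) =
      conjFun F E c N J₁ (fun x => Ψ (κ x)) + conjFun F E c N J₁ (conjFun F E c N J₁ fun x => Φ₁ (κ x)) := by
    rw [conjFun_conjFun']
    funext x
    show Φ₁ (κ x) + star (Ψ (κ x)) = star (Ψ (κ x)) + Φ₁ (κ x)
    rw [add_comm]
  rw [hsum]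
  exact Submodule.add_mem_sup (conjFun_comp_mem_holCotForms_of_conj hrel hΓ hK hfin hκf hΨ)
    (Submodule.mem_map_of_mem (conjFun_comp_mem_holCotForms_of_conj hrel hΓ hK hfin hκf h₁))

end Literature.NumberTheory.Automorphic.UnitaryGroup.CotangentForms

end
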